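import Literature.AnabelianGeometry.SemiGraphs.TemperedReconstructionR2bOfImagesAt
import Literature.AnabelianGeometry.SemiGraphs.TemperedReconstructionCor39UpToTwistAssemblyAt
import Literature.AnabelianGeometry.SemiGraphs.TemperedReconstructionCor39UpToTwistProofs
import HarnessLib

/-!
# [SemiAnbd] Cor. 3.9 (b), up to twist, AT ONE PAIR from IMAGE DATA — no Def. 3.8, no Thm. 3.7 (iii)/(iv) at
# either side (row «COR39b-ISO@TOP-CYCLIC», file 2/3)

Mochizuki, *Semi-graphs of anabelioids*, Publ. RIMS **42** (2006), §3, Corollary 3.9 and its proof, manuscript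
pp. 42–43 (p. 43 l. 13–15: "[again by Theorem 3.7, (iii), (iv)]") [cite: MochizukiSemiAnbd2006, Cor 3.9 pp.42-43].

PROOF-ONLY file (abc-iut cell, layer L3, seat abc-iut-L3-t10 gen 14; 0 definitions, no named fact; L3 lead gen 8
δ14 (2) GO; LF-SGA cell F-1710 / F-2771).  The cell's per-pair (b)-chain (abc-iut-w4-d083 (R2′) → abc-iut-w4-d064
(R3) → abc-iut-w4-d080 base uniqueness; this lineage's gen-8 «source halves» form) takes at the TARGET `H` the
per-graph Thm. 3.7 (iii) and (iv), which FAIL on the class TOP-CYCLIC (rayless star `𝒢⋆(p)`, abc-iut-L3-t8;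
file `MetabelianLeafStarCor39bTarget` of this seat: there clause (b) genuinely fails for a fold with COMMUTATIVE
image).  Here the chain is re-run with exactly what its proofs read:

* `exists_hom_of_images_of_compatVAt` — the locally open `F : G → H` compatible with `φ` on verticial and edge
  homomorphisms (gen-8's engine VERBATIM), from the IMAGE DATA (himg)/(himgE), the non-folding clause read on
  verticial subgroups (hcompatV), the second sentence of Thm. 3.7 (iii) at the chart (`hℋiii₂`, file 1/3) and
  `EdgeLikeDistinctAt ℋ`;
* ★ `cor39b_upToTwist_baseAt_of_imagesAt` — **clause (b) of Cor. 3.9 up to twist AT the pair from image data**: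
  `φ` is induced up to twist by a locally open `F` (abc-iut-w4-d064's (R3a) `twistAbsorption_holds`, which needs
  only (R3c) `EdgeLikeCentralizerAt ℋ cℋ`), and `F.base` is unique (abc-iut-w4-d080, hypothesis-free); named
  currency `cor39b_inducesUpToTwist_of_imagesAt`.

File 3/3 (`TemperedReconstructionCor39bIsoOfTopCyclic`) discharges every hypothesis on the class TOP-CYCLIC for an
ISOMORPHISM of chart groups (abc-iut-L3-t5 p503472, abc-iut-f-172, `compactInTwoVerticial_of_topCyclic`).  HONEST
FRAMING: a re-plumbing of OUR per-pair typing at infinite graphs of anabelioids; outside the [IUTchIII] Cor. 3.12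
cone (every print consumer of Cor. 3.9 has a finite dual graph, where (b) is a theorem of the finite files); Cor. 3.9
as printed is not touched; nothing asserts abc proved or refuted; no side is taken on [IUTchIII] Cor. 3.12;
typed ≠ proved.
-/

open CategoryTheory Topology

namespace Literature.AnabelianGeometry.SemiGraphs

namespace ProfiniteSemiGraph

universe u

variable {𝒢 ℋ : ProfiniteSemiGraph.{u}}

/-! ### The locally open morphism from image data -/

/-- Openness of the range of a lift through an embedding (abc-iut-w4-d083's private lemma, re-declared).
[folklore] -/
private theorem isOpen_range_lift'' {A B C : Type*} [Group A] [TopologicalSpace A] [Group B]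
    [TopologicalSpace B] [Group C] [TopologicalSpace C] (β : B →ₜ* C)
    (γ : A →ₜ* B) (S : Subgroup C) (hS : ∀ a, β (γ a) ∈ S)
    (hS' : ∀ b, β b ∈ S → b ∈ γ.toMonoidHom.range)
    (hopen : IsOpen ((Subtype.val : β.toMonoidHom.range → C) ⁻¹' (S : Set C))) :
    IsOpen (γ.toMonoidHom.range : Set B) := by
  let f : B → β.toMonoidHom.range := fun b => ⟨β b, ⟨b, rfl⟩⟩
  have hf : Continuous f := β.continuous.subtype_mk _
  have hset : (γ.toMonoidHom.range : Set B) =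
      f ⁻¹' ((Subtype.val : β.toMonoidHom.range → C) ⁻¹' (S : Set C)) := by
    ext b
    simp only [SetLike.mem_coe, Set.mem_preimage, f]
    constructor
    · rintro ⟨a, rfl⟩; exact hS a
    · exact hS' b
  rw [hset]
  exact hopen.preimage hf

/-- **[SemiAnbd] Cor. 3.9, proof, pp. 42–43 — the locally open morphism (residual (R2′)) AT the pair `(𝒢, ℋ)`
FROM IMAGE DATA** (twin of this lineage's gen-8 `exists_hom_of_isQuasiGeometric_of_compat_halvesAt`, itself a twin
of abc-iut-w4-d083's `exists_hom_of_isQuasiGeometric_of_compatAt`; proof verbatim up to the five call sites): from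
Thm. 3.7 (i), (ii), `EdgeLikeDistinct` at `ℋ`, the SECOND SENTENCE of Thm. 3.7 (iii) at the chart `cℋ` (`hℋiii₂`),
and the image data (himg) «verticial subgroups go onto open subgroups of verticial subgroups», (himgE) «nontrivial
edge-like subgroups go onto open subgroups of edge-like subgroups», (hcompatV) «two DISTINCT verticial subgroups
meeting nontrivially go into two distinct verticial subgroups» (the non-folding clause of the compatible reading of
Def. 3.8, read on verticial subgroups), a continuous `φ : π₁^temp(G) → π₁^temp(H)` admits a locally open morphism of
semi-graphs of anabelioids `F : G → H` compatible with `φ` on verticial and edge homomorphisms up to conjugation.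
NO quasi-geometricity, NO Thm. 3.7 (iii)/(iv) at either side. [cite: MochizukiSemiAnbd2006, Cor 3.9 pp.42-43] -/
theorem exists_hom_of_images_of_compatVAt (h37i : VerticialInjective.{u})
    (h37ii : VerticialDistinct.{u}) (hED : EdgeLikeDistinctAt ℋ) (h𝒢 : Cor39Hypotheses 𝒢)
    (hℋ : Cor39Hypotheses ℋ) (c𝒢 : TemperedPiChart 𝒢) (cℋ : TemperedPiChart ℋ)
    (hℋiii₂ : ∀ (C : Subgroup cℋ.G), IsCompact (C : Set cℋ.G) → C ≠ ⊥ →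
      ∀ (v₁ v₂ : ℋ.graph.Vertex) (H₁ H₂ : Subgroup cℋ.G), H₁ ∈ verticialSubgroups cℋ v₁ →
        H₂ ∈ verticialSubgroups cℋ v₂ → H₁ ≠ H₂ → C ≤ H₁ → C ≤ H₂ →
          ∀ (v₃ : ℋ.graph.Vertex) (H₃ : Subgroup cℋ.G), H₃ ∈ verticialSubgroups cℋ v₃ → C ≤ H₃ →
            H₃ = H₁ ∨ H₃ = H₂)
    (φ : c𝒢.G →ₜ* cℋ.G)
    (himg : ∀ (v : 𝒢.graph.Vertex) (K : Subgroup c𝒢.G), K ∈ verticialSubgroups c𝒢 v →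
      ∃ (w : ℋ.graph.Vertex) (K₂ : Subgroup cℋ.G), K₂ ∈ verticialSubgroups cℋ w ∧
        MapsOntoOpenSubgroupOf φ.toMonoidHom K K₂)
    (himgE : ∀ (e : 𝒢.graph.Edge) (L : Subgroup c𝒢.G), L ∈ edgeLikeSubgroups c𝒢 e → L ≠ ⊥ →
      ∃ (e' : ℋ.graph.Edge) (L₂ : Subgroup cℋ.G), L₂ ∈ edgeLikeSubgroups cℋ e' ∧
        MapsOntoOpenSubgroupOf φ.toMonoidHom L L₂)
    (hcompatV : ∀ (v₁ v₂ : 𝒢.graph.Vertex) (K₁ H₁ : Subgroup c𝒢.G), K₁ ∈ verticialSubgroups c𝒢 v₁ →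
      H₁ ∈ verticialSubgroups c𝒢 v₂ → K₁ ≠ H₁ → K₁ ⊓ H₁ ≠ ⊥ →
        ∃ (u₁ u₂ : ℋ.graph.Vertex) (K₂ H₂ : Subgroup cℋ.G), K₂ ∈ verticialSubgroups cℋ u₁ ∧
          H₂ ∈ verticialSubgroups cℋ u₂ ∧ K₂ ≠ H₂ ∧ K₁.map φ.toMonoidHom ≤ K₂ ∧
            H₁.map φ.toMonoidHom ≤ H₂) :
    ∃ F : Hom 𝒢 ℋ, F.IsLocallyOpen ∧ F.CompatV c𝒢 cℋ φ ∧ F.CompatE c𝒢 cℋ φ := by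
  classical
  have h𝒢37 := h𝒢.thm37Hypotheses
  have hℋ37 := hℋ.thm37Hypotheses
  haveI := TemperedPiChart.t2Space cℋ
  haveI := TemperedPiChart.t2Space c𝒢
  -- verticial homomorphisms
  choose ψ hψ using exists_isVerticialHom_of_thm37i h37i h𝒢37 c𝒢
  choose Ψ hΨ using exists_isVerticialHom_of_thm37i h37i hℋ37 cℋ
  -- the vertex map and the verticial homomorphisms `χ v` of `H` hosting the images
  obtain ⟨fV, hfV, -⟩ :=
    existsUnique_vertexMap_of_imagesAt h37i h37ii h𝒢37 hℋ37 c𝒢 cℋ φ himg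
  have hχ' : ∀ v, ∃ χ : ℋ.Gv (fV v) →ₜ* cℋ.G, IsVerticialHom cℋ (fV v) χ ∧
      MapsOntoOpenSubgroupOf φ.toMonoidHom (ψ v).toMonoidHom.range χ.toMonoidHom.range := by
    intro v
    obtain ⟨K₂, ⟨χ, hχ, rfl⟩, hm⟩ := hfV v _ (range_mem_verticialSubgroups c𝒢 (ψ v) (hψ v))
    exact ⟨χ, hχ, hm⟩
  choose χ hχ hmapsV using hχ'
  have hinjχ : ∀ v, Function.Injective (χ v) := fun v => (h37i ℋ hℋ37 cℋ (fV v)).2 (χ v) (hχ v)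
  have hliftV : ∀ v, ∃ γ : 𝒢.Gv v →ₜ* ℋ.Gv (fV v), ∀ y, χ v (γ y) = (φ.comp (ψ v)) y := fun v =>
    exists_lift_of_range_le (φ.comp (ψ v)) (χ v) (hinjχ v) (by
      rintro _ ⟨y, rfl⟩; exact (hmapsV v).1 ⟨ψ v y, ⟨y, rfl⟩, rfl⟩)
  choose hV hhV' using hliftV
  have hhV : ∀ v y, χ v (hV v y) = φ (ψ v y) := fun v y => by simpa using hhV' v y
  -- injective edge homomorphisms of `G`, the edge map, the edge homomorphisms `χE e` of `H`
  choose ψE hψE hinjψE using exists_isEdgeHom_injective_of_edge h37i h𝒢 c𝒢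
  obtain ⟨fE, hfE, -⟩ :=
    existsUnique_edgeMap_of_imagesAt h37i hED h𝒢 hℋ c𝒢 cℋ φ himgE
  have hχE' : ∀ e, ∃ χ' : ℋ.Ge (fE e) →ₜ* cℋ.G, IsEdgeHom cℋ (fE e) χ' ∧
      MapsOntoOpenSubgroupOf φ.toMonoidHom (ψE e).toMonoidHom.range χ'.toMonoidHom.range := by
    intro e
    obtain ⟨L₂, ⟨χ', hχ', rfl⟩, hm⟩ := hfE e _ ⟨ψE e, hψE e, rfl⟩
    exact ⟨χ', hχ', hm⟩
  choose χE hχE hmapsE using hχE'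
  have hinjχE : ∀ e, Function.Injective (χE e) := fun e =>
    injective_of_isEdgeHom_of_edge h37i hℋ cℋ (χE e) (hχE e)
  have hliftE : ∀ e, ∃ η : 𝒢.Ge e →ₜ* ℋ.Ge (fE e), ∀ x, χE e (η x) = (φ.comp (ψE e)) x := fun e =>
    exists_lift_of_range_le (φ.comp (ψE e)) (χE e) (hinjχE e) (by
      rintro _ ⟨x, rfl⟩; exact (hmapsE e).1 ⟨ψE e x, ⟨x, rfl⟩, rfl⟩)
  choose hE hhE' using hliftE
  have hhE : ∀ e x, χE e (hE e x) = φ (ψE e x) := fun e x => by simpa using hhE' e x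
  -- the vertex of a branch (G is a graph)
  have habuts : ∀ b : 𝒢.graph.Branch, ∃ v, 𝒢.graph.abuts b = some v := fun b =>
    Option.isSome_iff_exists.mp (h𝒢.isGraph.abuts_isSome b)
  choose vtx hvtx using habuts
  have hvtx_eq : ∀ {b : 𝒢.graph.Branch} {v : 𝒢.graph.Vertex}, 𝒢.graph.abuts b = some v → v = vtx b :=
    fun {b v} h => Option.some_injective _ (h.symm.trans (hvtx b))
  -- conjugators `a_b`: `ψ_v ∘ b_* = γ_{a_b} ∘ ψE_e`
  have ha' : ∀ b : 𝒢.graph.Branch, ∃ a : c𝒢.G, ∀ x,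
      a * ψE (𝒢.graph.edgeOf b) x * a⁻¹ = ψ (vtx b) (𝒢.brHom b (vtx b) (hvtx b) x) := fun b =>
    exists_conj_comp_brHom c𝒢 (hvtx b) (ψ (vtx b)) (hψ (vtx b)) (ψE _) (hψE _)
  choose a ha using ha'
  -- the target branches with their 2-cells
  have hcore : ∀ b : 𝒢.graph.Branch, ∃ (b' : ℋ.graph.Branch)
      (q : ℋ.graph.edgeOf b' = fE (𝒢.graph.edgeOf b))
      (h' : ℋ.graph.abuts b' = some (fV (vtx b))) (k : cℋ.G) (γ : ℋ.Gv (fV (vtx b))),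
      (∀ y, k * χE (𝒢.graph.edgeOf b) y * k⁻¹ =
          Ψ (fV (vtx b)) (ℋ.brHomAt b' (fV (vtx b)) h' (fE (𝒢.graph.edgeOf b)) q y)) ∧
      (χ (vtx b)).toMonoidHom.range.map (MulAut.conj (φ (a b))⁻¹).toMonoidHom =
        (Ψ (fV (vtx b))).toMonoidHom.range.map (MulAut.conj k⁻¹).toMonoidHom ∧
      ∀ x, hV (vtx b) (𝒢.brHom b (vtx b) (hvtx b) x) =
        γ * ℋ.brHomAt b' (fV (vtx b)) h' (fE (𝒢.graph.edgeOf b)) q (hE (𝒢.graph.edgeOf b) x) * γ⁻¹ :=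
    fun b => exists_target_branch_comm_of_twoVerticialAt h37i h37ii hℋ c𝒢 cℋ hℋiii₂ φ Ψ hΨ (ψ (vtx b))
      (χ (vtx b))
      (hχ (vtx b)) (hV (vtx b)) (hhV (vtx b)) (hvtx b) (ψE (𝒢.graph.edgeOf b)) (a b) (ha b)
      (χE (𝒢.graph.edgeOf b)) (hχE _) (hE _) (hhE _) (hmapsE _)
  choose fB hqB hhB kB γB hkB hhostB hcommB using hcore
  -- the hosts `Wt b` of the images and their source hosts `V b`
  have hWt : ∀ b, (χ (vtx b)).toMonoidHom.range.map (MulAut.conj (φ (a b))⁻¹).toMonoidHom ∈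
      verticialSubgroups cℋ (fV (vtx b)) := fun b =>
    conj_mem_verticialSubgroups cℋ (range_mem_verticialSubgroups cℋ (χ (vtx b)) (hχ (vtx b))) _
  have hVb : ∀ b, (ψ (vtx b)).toMonoidHom.range.map (MulAut.conj (a b)⁻¹).toMonoidHom ∈
      verticialSubgroups c𝒢 (vtx b) := fun b =>
    conj_mem_verticialSubgroups c𝒢 (range_mem_verticialSubgroups c𝒢 (ψ (vtx b)) (hψ (vtx b))) _
  have hLV : ∀ b, (ψE (𝒢.graph.edgeOf b)).toMonoidHom.range ≤
      ((𝒢.branchSubgroup b (vtx b) (hvtx b)).map (ψ (vtx b)).toMonoidHom).map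
        (MulAut.conj (a b)⁻¹).toMonoidHom := by
    intro b
    rintro _ ⟨x, rfl⟩
    refine ⟨ψ (vtx b) (𝒢.brHom b (vtx b) (hvtx b) x), ⟨_, ⟨x, rfl⟩, rfl⟩, ?_⟩
    show (a b)⁻¹ * ψ (vtx b) (𝒢.brHom b (vtx b) (hvtx b) x) * (a b)⁻¹⁻¹ = ψE _ x
    rw [← ha b x]; group
  -- the image of `V b` lies in `Wt b`, onto an open subgroup
  have hmapsVb : ∀ b, MapsOntoOpenSubgroupOf φ.toMonoidHom
      ((ψ (vtx b)).toMonoidHom.range.map (MulAut.conj (a b)⁻¹).toMonoidHom)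
      ((χ (vtx b)).toMonoidHom.range.map (MulAut.conj (φ (a b))⁻¹).toMonoidHom) := by
    intro b
    obtain ⟨W₀, hW₀, hm⟩ := hfV (vtx b) _ (hVb b)
    have hle : ((ψ (vtx b)).toMonoidHom.range.map (MulAut.conj (a b)⁻¹).toMonoidHom).map φ.toMonoidHom ≤
        (χ (vtx b)).toMonoidHom.range.map (MulAut.conj (φ (a b))⁻¹).toMonoidHom := by
      rintro _ ⟨_, ⟨_, ⟨y, rfl⟩, rfl⟩, rfl⟩
      refine ⟨φ (ψ (vtx b) y), ⟨hV (vtx b) y, hhV (vtx b) y⟩, ?_⟩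
      show (φ (a b))⁻¹ * φ (ψ (vtx b) y) * ((φ (a b))⁻¹)⁻¹ =
        φ ((a b)⁻¹ * ψ (vtx b) y * ((a b)⁻¹)⁻¹)
      simp only [map_mul, map_inv]
    have := host_eq_of_mapsOnto h37ii hℋ37 cℋ φ.toMonoidHom hW₀ hm (hWt b) hle
    rw [this]; exact hm
  -- NON-FOLDING: the two branches of an edge go to different branches
  have hinjB : ∀ b₁ b₂ : 𝒢.graph.Branch, 𝒢.graph.edgeOf b₁ = 𝒢.graph.edgeOf b₂ →
      fB b₁ = fB b₂ → b₁ = b₂ := by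
    intro b₁ b₂ heq hfb
    by_contra hne
    -- the source hosts are distinct maximal compact subgroups meeting nontrivially
    have hL0 : (ψE (𝒢.graph.edgeOf b₁)).toMonoidHom.range ≠ ⊥ := by
      intro h0
      haveI := infinite_of_mem_edgeLikeSubgroups h37i h𝒢37 c𝒢
        (⟨ψE _, hψE (𝒢.graph.edgeOf b₁), rfl⟩ :
          (ψE (𝒢.graph.edgeOf b₁)).toMonoidHom.range ∈ edgeLikeSubgroups c𝒢 _)
      rw [h0] at this
      exact not_finite (⊥ : Subgroup c𝒢.G)
    have hLV₂ : (ψE (𝒢.graph.edgeOf b₁)).toMonoidHom.range ≤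
        ((𝒢.branchSubgroup b₂ (vtx b₂) (hvtx b₂)).map (ψ (vtx b₂)).toMonoidHom).map
          (MulAut.conj (a b₂)⁻¹).toMonoidHom := by rw [heq]; exact hLV b₂
    have hVne : (ψ (vtx b₁)).toMonoidHom.range.map (MulAut.conj (a b₁)⁻¹).toMonoidHom ≠
        (ψ (vtx b₂)).toMonoidHom.range.map (MulAut.conj (a b₂)⁻¹).toMonoidHom := fun hEq =>
      hne (branch_eq_of_hosts_eq h37ii h37i h𝒢37 c𝒢 ψ hψ hL0 (hvtx b₁) (hvtx b₂) (a b₁)⁻¹ (a b₂)⁻¹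
        (hLV b₁) hLV₂ hEq)
    have hVmeet : (ψ (vtx b₁)).toMonoidHom.range.map (MulAut.conj (a b₁)⁻¹).toMonoidHom ⊓
        (ψ (vtx b₂)).toMonoidHom.range.map (MulAut.conj (a b₂)⁻¹).toMonoidHom ≠ ⊥ := fun h0 =>
      hL0 (le_bot_iff.mp (h0 ▸ le_inf ((hLV b₁).trans (Subgroup.map_mono (Subgroup.map_le_range _ _)))
        (hLV₂.trans (Subgroup.map_mono (Subgroup.map_le_range _ _)))))
    obtain ⟨u₁, u₂, K₂, K₂', hK₂u, hK₂'u, hKne, hle₁, hle₂⟩ :=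
      hcompatV _ _ _ _ (hVb b₁) (hVb b₂) hVne hVmeet
    have hK₂eq := host_eq_of_mapsOnto h37ii hℋ37 cℋ φ.toMonoidHom (hWt b₁) (hmapsVb b₁) hK₂u hle₁
    have hK₂'eq := host_eq_of_mapsOnto h37ii hℋ37 cℋ φ.toMonoidHom (hWt b₂) (hmapsVb b₂) hK₂'u hle₂
    -- so the image hosts differ; but the common target branch forces them to agree
    apply hKne
    rw [hK₂eq, hK₂'eq, hhostB b₁, hhostB b₂]
    -- align the vertices `fV (vtx b₁) = fV (vtx b₂)` and edges
    have hw : fV (vtx b₁) = fV (vtx b₂) :=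
      Option.some_injective _ ((hhB b₁).symm.trans (hfb ▸ hhB b₂))
    -- subgroup-level conjugacy data for the common branch
    have hsub : ∀ b : 𝒢.graph.Branch,
        (χE (𝒢.graph.edgeOf b)).toMonoidHom.range.map (MulAut.conj (kB b)).toMonoidHom ≤
          (ℋ.branchSubgroup (fB b) (fV (vtx b)) (hhB b)).map (Ψ (fV (vtx b))).toMonoidHom := by
      intro b
      rintro _ ⟨_, ⟨y, rfl⟩, rfl⟩
      exact ⟨ℋ.brHomAt (fB b) (fV (vtx b)) (hhB b) _ (hqB b) y,
        brHomAt_mem_branchSubgroup (hhB b) (hqB b) y, (hkB b y).symm⟩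
    -- transport the `b₂` data to the indices of `b₁`
    have key : ∀ (w₁ w₂ : ℋ.graph.Vertex) (hw : w₁ = w₂) (c : ℋ.graph.Branch)
        (h₁ : ℋ.graph.abuts c = some w₁) (h₂ : ℋ.graph.abuts c = some w₂),
        (ℋ.branchSubgroup c w₂ h₂).map (Ψ w₂).toMonoidHom =
          (ℋ.branchSubgroup c w₁ h₁).map (Ψ w₁).toMonoidHom ∧
        ∀ k : cℋ.G, (Ψ w₂).toMonoidHom.range.map (MulAut.conj k).toMonoidHom =
          (Ψ w₁).toMonoidHom.range.map (MulAut.conj k).toMonoidHom := by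
      intro w₁ w₂ hw c h₁ h₂; subst hw; exact ⟨rfl, fun _ => rfl⟩
    obtain ⟨hbr, hrg⟩ := key _ _ hw (fB b₁) (hhB b₁) (hfb ▸ hhB b₂)
    have hsub₂ : (χE (𝒢.graph.edgeOf b₁)).toMonoidHom.range.map (MulAut.conj (kB b₂)).toMonoidHom ≤
        (ℋ.branchSubgroup (fB b₁) (fV (vtx b₁)) (hhB b₁)).map (Ψ (fV (vtx b₁))).toMonoidHom := by
      have h2 := hsub b₂
      rw [← heq] at h2
      -- `fB b₂ = fB b₁` in the branch subgroup
      have key2 : ∀ (c₁ c₂ : ℋ.graph.Branch) (hc : c₁ = c₂) (h₁ : ℋ.graph.abuts c₁ = some (fV (vtx b₂)))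
          (h₂ : ℋ.graph.abuts c₂ = some (fV (vtx b₂))),
          (ℋ.branchSubgroup c₂ _ h₂).map (Ψ _).toMonoidHom = (ℋ.branchSubgroup c₁ _ h₁).map (Ψ _).toMonoidHom := by
        intro c₁ c₂ hc h₁ h₂; subst hc; rfl
      rw [key2 (fB b₁) (fB b₂) hfb (hfb ▸ hhB b₂) (hhB b₂)] at h2
      rwa [hbr] at h2
    rw [hrg (kB b₂)⁻¹]
    exact host_unique_of_branch_of_twoVerticialAt h37i h37ii hℋ cℋ hℋiii₂ Ψ hΨ (χE (𝒢.graph.edgeOf b₁))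
      (hχE _)
      (hhB b₁) (hqB b₁) (kB b₁) (kB b₂) (hsub b₁) hsub₂
  -- the morphism
  refine ⟨{ base :=
              { vertexMap := fV
                edgeMap := fE
                branchMap := fB
                edgeOf_branchMap := hqB
                branchMap_injOn := hinjB
                abuts_branchMap := fun b v h => by rw [hvtx_eq h]; exact hhB b }
            hV := hV
            hE := hE
            comm := fun b v h => by
              have hv := hvtx_eq h
              subst hv
              exact ⟨γB b, fun x => by rw [hcommB b x, brHomAt_apply]⟩ }, ⟨?_, ?_⟩, ?_, ?_⟩
  · -- open image on vertices
    intro v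
    refine isOpen_range_lift'' (χ v) (hV v) ((ψ v).toMonoidHom.range.map φ.toMonoidHom)
      (fun y => ⟨ψ v y, ⟨y, rfl⟩, (hhV v y).symm⟩) (fun y hy => ?_) (hmapsV v).2
    obtain ⟨_, ⟨x, rfl⟩, hx⟩ := hy
    refine ⟨x, hinjχ v ?_⟩
    change φ (ψ v x) = χ v y at hx
    rw [← hhV v x] at hx
    exact hx
  · -- open image on edges
    intro e
    refine isOpen_range_lift'' (χE e) (hE e) ((ψE e).toMonoidHom.range.map φ.toMonoidHom)
      (fun x => ⟨ψE e x, ⟨x, rfl⟩, (hhE e x).symm⟩) (fun y hy => ?_) (hmapsE e).2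
    obtain ⟨_, ⟨x, rfl⟩, hx⟩ := hy
    refine ⟨x, hinjχE e ?_⟩
    change φ (ψE e x) = χE e y at hx
    rw [← hhE e x] at hx
    exact hx
  · -- compatibility on verticial homomorphisms
    intro v ψ₁ ψ₁' hψ₁ hψ₁'
    obtain ⟨s, hs⟩ := exists_conj_of_isVerticialHom c𝒢 (ψ v) ψ₁ (hψ v) hψ₁
    obtain ⟨t, ht⟩ := exists_conj_of_isVerticialHom cℋ ψ₁' (χ v) hψ₁' (hχ v)
    refine ⟨φ s * t, fun x => ?_⟩
    show φ (ψ₁ x) = φ s * t * ψ₁' (hV v x) * (φ s * t)⁻¹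
    rw [← hs, map_mul, map_mul, map_inv, ← hhV, ← ht]
    group
  · -- compatibility on edge homomorphisms
    intro e ψ₁ ψ₁' hψ₁ hψ₁'
    obtain ⟨s, hs⟩ := exists_conj_of_isEdgeHom c𝒢 (ψE e) ψ₁ (hψE e) hψ₁
    obtain ⟨t, ht⟩ := exists_conj_of_isEdgeHom cℋ ψ₁' (χE e) hψ₁' (hχE e)
    refine ⟨φ s * t, fun x => ?_⟩
    show φ (ψ₁ x) = φ s * t * ψ₁' (hE e x) * (φ s * t)⁻¹
    rw [← hs, map_mul, map_mul, map_inv, ← hhE, ← ht]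
    group

/-! ### Corollary 3.9 (b), up to twist, AT the pair from image data -/

/-- ★ **[SemiAnbd] Cor. 3.9, clause (b), up to twist, AT the pair `(G, H)` FROM IMAGE DATA** — no Def. 3.8, no
Thm. 3.7 (iii)/(iv) at either side: a continuous `φ : π₁^temp(G) → π₁^temp(H)` carrying verticial subgroups onto
open subgroups of verticial subgroups (himg), nontrivial edge-like subgroups onto open subgroups of edge-like
subgroups (himgE), and distinct verticial subgroups meeting nontrivially into distinct verticial subgroups (hcompatV)
is induced up to twist by a LOCALLY OPEN morphism `F : G → H` (def-free currency of abc-iut-w4-d080: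
`∃ θ, B^temp(φ) ≅ c_H⁻¹ ⋙ F^*_θ ⋙ c_G`), and `F.base` is UNIQUE among locally open morphisms inducing `φ` up to twist.
Target inputs: (R3c) `EdgeLikeCentralizerAt ℋ cℋ` (for abc-iut-w4-d064's (R3a) `twistAbsorption_holds`),
`EdgeLikeDistinctAt ℋ`, and the second sentence of Thm. 3.7 (iii) at the chart; Thm. 3.7 (i), (ii) are tree
theorems (`verticialInjective_holds`, `verticialDistinct_holds`). [cite: MochizukiSemiAnbd2006, Cor 3.9 pp.42-43] -/
theorem cor39b_upToTwist_baseAt_of_imagesAt (h𝒢 : Cor39Hypotheses 𝒢) (hℋ : Cor39Hypotheses ℋ)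
    (c𝒢 : TemperedPiChart 𝒢) (cℋ : TemperedPiChart ℋ) (hR3c : EdgeLikeCentralizerAt ℋ cℋ)
    (hED : EdgeLikeDistinctAt ℋ)
    (hℋiii₂ : ∀ (C : Subgroup cℋ.G), IsCompact (C : Set cℋ.G) → C ≠ ⊥ →
      ∀ (v₁ v₂ : ℋ.graph.Vertex) (H₁ H₂ : Subgroup cℋ.G), H₁ ∈ verticialSubgroups cℋ v₁ →
        H₂ ∈ verticialSubgroups cℋ v₂ → H₁ ≠ H₂ → C ≤ H₁ → C ≤ H₂ →
          ∀ (v₃ : ℋ.graph.Vertex) (H₃ : Subgroup cℋ.G), H₃ ∈ verticialSubgroups cℋ v₃ → C ≤ H₃ →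
            H₃ = H₁ ∨ H₃ = H₂)
    (φ : c𝒢.G →ₜ* cℋ.G)
    (himg : ∀ (v : 𝒢.graph.Vertex) (K : Subgroup c𝒢.G), K ∈ verticialSubgroups c𝒢 v →
      ∃ (w : ℋ.graph.Vertex) (K₂ : Subgroup cℋ.G), K₂ ∈ verticialSubgroups cℋ w ∧
        MapsOntoOpenSubgroupOf φ.toMonoidHom K K₂)
    (himgE : ∀ (e : 𝒢.graph.Edge) (L : Subgroup c𝒢.G), L ∈ edgeLikeSubgroups c𝒢 e → L ≠ ⊥ →
      ∃ (e' : ℋ.graph.Edge) (L₂ : Subgroup cℋ.G), L₂ ∈ edgeLikeSubgroups cℋ e' ∧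
        MapsOntoOpenSubgroupOf φ.toMonoidHom L L₂)
    (hcompatV : ∀ (v₁ v₂ : 𝒢.graph.Vertex) (K₁ H₁ : Subgroup c𝒢.G), K₁ ∈ verticialSubgroups c𝒢 v₁ →
      H₁ ∈ verticialSubgroups c𝒢 v₂ → K₁ ≠ H₁ → K₁ ⊓ H₁ ≠ ⊥ →
        ∃ (u₁ u₂ : ℋ.graph.Vertex) (K₂ H₂ : Subgroup cℋ.G), K₂ ∈ verticialSubgroups cℋ u₁ ∧
          H₂ ∈ verticialSubgroups cℋ u₂ ∧ K₂ ≠ H₂ ∧ K₁.map φ.toMonoidHom ≤ K₂ ∧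
            H₁.map φ.toMonoidHom ≤ H₂) :
    ∃ F : Hom 𝒢 ℋ, F.IsLocallyOpen ∧
      (∃ θ : F.ConjugatorFamily, Nonempty (F.chartPullbackWith θ c𝒢 cℋ ≅ BTemp.res φ)) ∧
      ∀ F' : Hom 𝒢 ℋ, F'.IsLocallyOpen →
        (∃ θ' : F'.ConjugatorFamily, Nonempty (F'.chartPullbackWith θ' c𝒢 cℋ ≅ BTemp.res φ)) →
          F'.base = F.base := by
  obtain ⟨F, hF, hV, hE⟩ := exists_hom_of_images_of_compatVAt verticialInjective_holds verticialDistinct_holds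
    hED h𝒢 hℋ c𝒢 cℋ hℋiii₂ φ himg himgE hcompatV
  have hind : ∃ θ : F.ConjugatorFamily, Nonempty (F.chartPullbackWith θ c𝒢 cℋ ≅ BTemp.res φ) :=
    twistAbsorption_holds 𝒢 ℋ h𝒢 hℋ c𝒢 cℋ hR3c F φ hF hV hE
  exact ⟨F, hF, hind, fun F' hF' hind' =>
    base_eq_of_exists_chartPullbackWith_iso' h𝒢 hℋ c𝒢 cℋ F F' φ hF hF' hind hind'⟩

/-- The same in the named currency `Hom.InducesUpToTwist` (abc-iut-w4-d080's `Cor39CompatUpToTwist`, clause (b), at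
the pair, from image data). [cite: MochizukiSemiAnbd2006, Cor 3.9 pp.42-43] -/
theorem cor39b_inducesUpToTwist_of_imagesAt (h𝒢 : Cor39Hypotheses 𝒢) (hℋ : Cor39Hypotheses ℋ)
    (c𝒢 : TemperedPiChart 𝒢) (cℋ : TemperedPiChart ℋ) (hR3c : EdgeLikeCentralizerAt ℋ cℋ)
    (hED : EdgeLikeDistinctAt ℋ)
    (hℋiii₂ : ∀ (C : Subgroup cℋ.G), IsCompact (C : Set cℋ.G) → C ≠ ⊥ →
      ∀ (v₁ v₂ : ℋ.graph.Vertex) (H₁ H₂ : Subgroup cℋ.G), H₁ ∈ verticialSubgroups cℋ v₁ →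
        H₂ ∈ verticialSubgroups cℋ v₂ → H₁ ≠ H₂ → C ≤ H₁ → C ≤ H₂ →
          ∀ (v₃ : ℋ.graph.Vertex) (H₃ : Subgroup cℋ.G), H₃ ∈ verticialSubgroups cℋ v₃ → C ≤ H₃ →
            H₃ = H₁ ∨ H₃ = H₂)
    (φ : c𝒢.G →ₜ* cℋ.G)
    (himg : ∀ (v : 𝒢.graph.Vertex) (K : Subgroup c𝒢.G), K ∈ verticialSubgroups c𝒢 v →
      ∃ (w : ℋ.graph.Vertex) (K₂ : Subgroup cℋ.G), K₂ ∈ verticialSubgroups cℋ w ∧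
        MapsOntoOpenSubgroupOf φ.toMonoidHom K K₂)
    (himgE : ∀ (e : 𝒢.graph.Edge) (L : Subgroup c𝒢.G), L ∈ edgeLikeSubgroups c𝒢 e → L ≠ ⊥ →
      ∃ (e' : ℋ.graph.Edge) (L₂ : Subgroup cℋ.G), L₂ ∈ edgeLikeSubgroups cℋ e' ∧
        MapsOntoOpenSubgroupOf φ.toMonoidHom L L₂)
    (hcompatV : ∀ (v₁ v₂ : 𝒢.graph.Vertex) (K₁ H₁ : Subgroup c𝒢.G), K₁ ∈ verticialSubgroups c𝒢 v₁ →
      H₁ ∈ verticialSubgroups c𝒢 v₂ → K₁ ≠ H₁ → K₁ ⊓ H₁ ≠ ⊥ →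
        ∃ (u₁ u₂ : ℋ.graph.Vertex) (K₂ H₂ : Subgroup cℋ.G), K₂ ∈ verticialSubgroups cℋ u₁ ∧
          H₂ ∈ verticialSubgroups cℋ u₂ ∧ K₂ ≠ H₂ ∧ K₁.map φ.toMonoidHom ≤ K₂ ∧
            H₁.map φ.toMonoidHom ≤ H₂) :
    ∃ F : Hom 𝒢 ℋ, F.IsLocallyOpen ∧ F.InducesUpToTwist c𝒢 cℋ φ ∧
      ∀ F' : Hom 𝒢 ℋ, F'.IsLocallyOpen → F'.InducesUpToTwist c𝒢 cℋ φ → F'.base = F.base :=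
  cor39b_upToTwist_baseAt_of_imagesAt h𝒢 hℋ c𝒢 cℋ hR3c hED hℋiii₂ φ himg himgE hcompatV

end ProfiniteSemiGraph

end Literature.AnabelianGeometry.SemiGraphs
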